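import Literature.Computability.QuantumComplexity.RevExprCompile
import Literature.Computability.QuantumComplexity.DyadicThresholds
import HarnessLib

/-!
# The threshold predicates of the AJL gadgets as Boolean expressions

Topic `Literature/Computability/QuantumComplexity`; a step in the discharge of
`ajl_jonesApproxProblem_mem_PromiseBQP`. The seven dyadic thresholds of `DyadicThresholds.lean`
(`thr0_iff`, …, `thr6_iff`: `a < 2^k τ_j` decided by a subtraction-free integer polynomial
inequality) written as Boolean expressions `SLP.BExpr` over the `k`-bit input field `a`
(`RevExprCompile.lean`), with

* their semantics: `eval = decide ((a : ℝ) < 2^k τ_j)` (`SLP.thrB_eval`, `j = 0, …, 6`);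
* their side conditions `BExpr.OK (4k+16) kIn` for `k ≤ kIn` (`SLP.thrB_ok`);
* the overflow bound `maxBnd < 2^{4k+16}` (`SLP.thrB_maxBnd_lt`),

so that `SLP.BExpr.clEval_compile` turns each of them (and any Boolean combination with further input
bits, `SLP.bitB`) into a verified reversible program.

## References

* D. Aharonov, V. Jones, Z. Landau, Algorithmica 55 (2009) = arXiv:quant-ph/0511096, §2.12
  [AharonovJonesLandau2009].
* V. Vedral, A. Barenco, A. Ekert, Phys. Rev. A 54 (1996), §3 [VedralBarencoEkert1996].
-/

noncomputable section

namespace Literature.Computability.QuantumComplexity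

namespace SLP

open Real

/-! ### Generic facts on bounds -/

/-- Bounds are positive. [folklore] -/
theorem AExpr.one_le_bnd : ∀ e : AExpr, 1 ≤ e.bnd
  | .fld _ _ => Nat.one_le_two_pow
  | .pw _ => Nat.one_le_two_pow
  | .add e₁ _ _ => e₁.one_le_bnd.trans (Nat.le_add_right _ _)
  | .mul e₁ e₂ => by have := e₁.one_le_bnd; have := e₂.one_le_bnd; show 1 ≤ e₁.bnd * e₂.bnd; nlinarith

/-- The intermediate bound of an expression is its bound (bounds grow up the tree). [folklore] -/
theorem AExpr.maxBnd_le_bnd : ∀ e : AExpr, e.maxBnd ≤ e.bnd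
  | .fld _ _ => le_rfl
  | .pw _ => le_rfl
  | .add e₁ e₂ sh => by
    have h1 := e₁.maxBnd_le_bnd; have h2 := e₂.maxBnd_le_bnd
    have : e₂.bnd ≤ e₂.bnd * 2 ^ sh := Nat.le_mul_of_pos_right _ (Nat.two_pow_pos sh)
    simp only [AExpr.maxBnd, AExpr.bnd]; omega
  | .mul e₁ e₂ => by
    have h1 := e₁.maxBnd_le_bnd; have h2 := e₂.maxBnd_le_bnd
    have o1 := e₁.one_le_bnd; have o2 := e₂.one_le_bnd
    have : e₁.bnd ≤ e₁.bnd * e₂.bnd := Nat.le_mul_of_pos_right _ o2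
    have : e₂.bnd ≤ e₁.bnd * e₂.bnd := Nat.le_mul_of_pos_left _ o1
    simp only [AExpr.maxBnd, AExpr.bnd]; omega

/-! ### Building blocks -/

/-- The zero expression (the empty field). [folklore] -/
def zeroE : AExpr := .fld 0 0

/-- `e · 2^s`. [folklore] -/
def shlE (e : AExpr) (s : ℕ) : AExpr := .add zeroE e s

/-- The `k`-bit input field `a` at offset `0`. [folklore] -/
def aE (k : ℕ) : AExpr := .fld 0 k

/-- A single input bit at offset `off`, as a Boolean expression (`0 < bit`). [folklore] -/
def bitB (off : ℕ) : BExpr := .lt zeroE (.fld off 1)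

variable (inp : ℕ)

/-- The zero expression is `0`. [folklore] -/
@[simp] theorem zeroE_eval : zeroE.eval inp = 0 := by simp [zeroE, AExpr.eval, Nat.mod_one]
/-- Shifting multiplies by `2^s`. [folklore] -/
@[simp] theorem shlE_eval (e : AExpr) (s : ℕ) : (shlE e s).eval inp = e.eval inp * 2 ^ s := by simp [shlE, AExpr.eval]
/-- The field `a` is the input modulo `2^k`. [folklore] -/
@[simp] theorem aE_eval (k : ℕ) : (aE k).eval inp = inp % 2 ^ k := by simp [aE, AExpr.eval]
/-- Bound of the zero expression. [folklore] -/
@[simp] theorem zeroE_bnd : zeroE.bnd = 1 := by simp [zeroE, AExpr.bnd]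
/-- Bound of a shift. [folklore] -/
@[simp] theorem shlE_bnd (e : AExpr) (s : ℕ) : (shlE e s).bnd = 1 + e.bnd * 2 ^ s := by simp [shlE, AExpr.bnd]
/-- Bound of the field `a`. [folklore] -/
@[simp] theorem aE_bnd (k : ℕ) : (aE k).bnd = 2 ^ k := by simp [aE, AExpr.bnd]

/-- A bit test reads the bit. [folklore] -/
theorem bitB_eval (off : ℕ) : (bitB off).eval inp = inp.testBit off := by
  simp only [bitB, BExpr.eval, zeroE_eval, AExpr.eval, pow_one]
  rw [Nat.testBit_eq_decide_div_mod_eq]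
  rcases Nat.mod_two_eq_zero_or_one (inp / 2 ^ off) with h | h <;> simp [h]

/-! ### The seven thresholds as Boolean expressions (input field `a = inp mod 2^k`) -/

/-- `T₀ : 2a < 2^k`. [folklore] -/
def thr0B (k : ℕ) : BExpr := .lt (shlE (aE k) 1) (.pw k)

/-- `T₁ : 4a < 3·2^k ∧ 6·2^k a < 4^k + 4a²`. [folklore] -/
def thr1B (k : ℕ) : BExpr :=
  .and (.lt (shlE (aE k) 2) (.add (.pw k) (.pw k) 1))
    (.lt (.add (shlE (aE k) (k + 1)) (aE k) (k + 2)) (.add (.pw (2 * k)) (.mul (aE k) (aE k)) 2))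

/-- `P = 3·4^k + 8a²`. [folklore] -/
def pE (k : ℕ) : AExpr := .add (.add (.pw (2 * k)) (.pw (2 * k)) 1) (.mul (aE k) (aE k)) 3
/-- `Q = 8·2^k a`. [folklore] -/
def qE (k : ℕ) : AExpr := shlE (aE k) (k + 3)

/-- `T₂ : 2a < 2^k ∧ 5·16^k + 2PQ < P² + Q²`. [folklore] -/
def thr2B (k : ℕ) : BExpr :=
  .and (thr0B k) (.lt (.add (.add (.pw (4 * k)) (.pw (4 * k)) 2) (.mul (pE k) (qE k)) 1)
    (.add (.mul (pE k) (pE k)) (.mul (qE k) (qE k)) 0))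

/-- `P' = 4^k + 4a²`. [folklore] -/
def p'E (k : ℕ) : AExpr := .add (.pw (2 * k)) (.mul (aE k) (aE k)) 2
/-- `Q' = 4·2^k a`. [folklore] -/
def q'E (k : ℕ) : AExpr := shlE (aE k) (k + 2)

/-- `T₃ : 2a < 2^k ∨ P'² + Q'² + 4^k P' < 16^k + 2P'Q' + 4^k Q'`. [folklore] -/
def thr3B (k : ℕ) : BExpr :=
  .or (thr0B k) (.lt (.add (.add (.mul (p'E k) (p'E k)) (.mul (q'E k) (q'E k)) 0) (shlE (p'E k) (2 * k)) 0)
    (.add (.add (.pw (4 * k)) (.mul (p'E k) (q'E k)) 1) (shlE (q'E k) (2 * k)) 0))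

/-- `T₄ : 8a < 3·2^k ∨ 16a² + 4^k < 12·2^k a`. [folklore] -/
def thr4B (k : ℕ) : BExpr :=
  .or (.lt (shlE (aE k) 3) (.add (.pw k) (.pw k) 1))
    (.lt (.add (shlE (.mul (aE k) (aE k)) 4) (.pw (2 * k)) 0) (.add (shlE (aE k) (k + 2)) (aE k) (k + 3)))

/-- `P'' = 6·4^k + 64a²`. [folklore] -/
def p''E (k : ℕ) : AExpr := .add (.add (.pw (2 * k + 1)) (.pw (2 * k + 2)) 0) (.mul (aE k) (aE k)) 6
/-- `Q'' = 64·2^k a`. [folklore] -/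
def q''E (k : ℕ) : AExpr := shlE (aE k) (k + 6)

/-- `T₅ : 2a < 2^k ∧ Q'' < P'' ∧ 20·16^k + 2P''Q'' < P''² + Q''²`. [folklore] -/
def thr5B (k : ℕ) : BExpr :=
  .and (thr0B k) (.and (.lt (q''E k) (p''E k))
    (.lt (.add (.add (.pw (4 * k + 2)) (.pw (4 * k + 4)) 0) (.mul (p''E k) (q''E k)) 1)
      (.add (.mul (p''E k) (p''E k)) (.mul (q''E k) (q''E k)) 0)))

/-- `T₆ : 4a < 2^k ∨ 16a² < 4·4^k + 8·2^k a`. [folklore] -/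
def thr6B (k : ℕ) : BExpr :=
  .or (.lt (shlE (aE k) 2) (.pw k)) (.lt (shlE (.mul (aE k) (aE k)) 4) (.add (.pw (2 * k + 2)) (aE k) (k + 3)))

/-! ### Semantics -/

section Eval

variable (k : ℕ)

/-- `4^k = 2^{2k}`. [folklore] -/
theorem four_pow_eq_two_pow : (4 : ℕ) ^ k = 2 ^ (2 * k) := by rw [pow_mul]; norm_num
/-- `16^k = 2^{4k}`. [folklore] -/
theorem sixteen_pow_eq_two_pow : (16 : ℕ) ^ k = 2 ^ (4 * k) := by rw [pow_mul]; norm_num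

/-- `T₁` computes its integer inequality. [folklore] -/
theorem thr1B_eval_nat : (thr1B k).eval inp =
    decide (4 * (inp % 2 ^ k) < 3 * 2 ^ k ∧ 6 * 2 ^ k * (inp % 2 ^ k) < 4 ^ k + 4 * (inp % 2 ^ k) ^ 2) := by
  simp only [thr1B, BExpr.eval, AExpr.eval, shlE_eval, aE_eval, Bool.decide_and, four_pow_eq_two_pow, pow_succ, pow_zero,
    pow_mul, one_mul]
  congr 1 <;> apply Bool.decide_congr <;> constructor <;> intro h <;> · ring_nf at h ⊢; omega

/-- `T₁` decides `a < 2^k (3 − √5)/4`. [folklore] -/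
theorem thr1B_eval : (thr1B k).eval inp = decide (((inp % 2 ^ k : ℕ) : ℝ) < 2 ^ k * ((3 - Real.sqrt 5) / 4)) := by
  rw [thr1B_eval_nat]; exact Bool.decide_congr (thr1_iff k _)

/-- `T₀` computes its integer inequality. [folklore] -/
theorem thr0B_eval_nat : (thr0B k).eval inp = decide (2 * (inp % 2 ^ k) < 2 ^ k) := by
  simp only [thr0B, BExpr.eval, AExpr.eval, shlE_eval, aE_eval, pow_one]
  apply Bool.decide_congr; constructor <;> intro h <;> omega

/-- `T₂` computes its integer inequality. [folklore] -/
theorem thr2B_eval_nat : (thr2B k).eval inp =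
    decide (2 * (inp % 2 ^ k) < 2 ^ k ∧ 5 * 16 ^ k + 2 * ((3 * 4 ^ k + 8 * (inp % 2 ^ k) ^ 2) * (8 * 2 ^ k * (inp % 2 ^ k))) <
      (3 * 4 ^ k + 8 * (inp % 2 ^ k) ^ 2) ^ 2 + (8 * 2 ^ k * (inp % 2 ^ k)) ^ 2) := by
  rw [Bool.decide_and, ← thr0B_eval_nat]
  simp only [thr2B, pE, qE, BExpr.eval, AExpr.eval, shlE_eval, aE_eval, four_pow_eq_two_pow, sixteen_pow_eq_two_pow,
    pow_succ, pow_zero, pow_mul', one_mul]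
  congr 1; apply Bool.decide_congr; constructor <;> intro h <;> · ring_nf at h ⊢; omega

/-- `T₃` computes its integer inequality. [folklore] -/
theorem thr3B_eval_nat : (thr3B k).eval inp =
    decide (2 * (inp % 2 ^ k) < 2 ^ k ∨ (4 * (inp % 2 ^ k) ^ 2 + 4 ^ k) ^ 2 + (4 * 2 ^ k * (inp % 2 ^ k)) ^ 2 + 4 ^ k * (4 * (inp % 2 ^ k) ^ 2 + 4 ^ k) <
      16 ^ k + 2 * ((4 * (inp % 2 ^ k) ^ 2 + 4 ^ k) * (4 * 2 ^ k * (inp % 2 ^ k))) + 4 ^ k * (4 * 2 ^ k * (inp % 2 ^ k))) := by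
  rw [Bool.decide_or, ← thr0B_eval_nat]
  simp only [thr3B, p'E, q'E, BExpr.eval, AExpr.eval, shlE_eval, aE_eval, four_pow_eq_two_pow, sixteen_pow_eq_two_pow,
    pow_succ, pow_zero, pow_mul', one_mul]
  congr 1; apply Bool.decide_congr; constructor <;> intro h <;> · ring_nf at h ⊢; omega

/-- `T₄` computes its integer inequality. [folklore] -/
theorem thr4B_eval_nat : (thr4B k).eval inp =
    decide (8 * (inp % 2 ^ k) < 3 * 2 ^ k ∨ 16 * (inp % 2 ^ k) ^ 2 + 4 ^ k < 12 * 2 ^ k * (inp % 2 ^ k)) := by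
  rw [Bool.decide_or]
  simp only [thr4B, BExpr.eval, AExpr.eval, shlE_eval, aE_eval, four_pow_eq_two_pow, pow_succ, pow_zero, pow_mul',
    one_mul]
  congr 1 <;> apply Bool.decide_congr <;> constructor <;> intro h <;> · ring_nf at h ⊢; omega

/-- `T₅` computes its integer inequality. [folklore] -/
theorem thr5B_eval_nat : (thr5B k).eval inp =
    decide (2 * (inp % 2 ^ k) < 2 ^ k ∧ 64 * 2 ^ k * (inp % 2 ^ k) < 6 * 4 ^ k + 64 * (inp % 2 ^ k) ^ 2 ∧
      20 * 16 ^ k + 2 * ((6 * 4 ^ k + 64 * (inp % 2 ^ k) ^ 2) * (64 * 2 ^ k * (inp % 2 ^ k))) <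
        (6 * 4 ^ k + 64 * (inp % 2 ^ k) ^ 2) ^ 2 + (64 * 2 ^ k * (inp % 2 ^ k)) ^ 2) := by
  rw [Bool.decide_and, Bool.decide_and, ← thr0B_eval_nat]
  simp only [thr5B, p''E, q''E, BExpr.eval, AExpr.eval, shlE_eval, aE_eval, four_pow_eq_two_pow, sixteen_pow_eq_two_pow,
    pow_succ, pow_zero, pow_mul', one_mul]
  congr 1; congr 1 <;> apply Bool.decide_congr <;> constructor <;> intro h <;> · ring_nf at h ⊢; omega

/-- `T₆` computes its integer inequality. [folklore] -/
theorem thr6B_eval_nat : (thr6B k).eval inp =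
    decide (4 * (inp % 2 ^ k) < 2 ^ k ∨ 16 * (inp % 2 ^ k) ^ 2 < 4 * 4 ^ k + 8 * 2 ^ k * (inp % 2 ^ k)) := by
  rw [Bool.decide_or]
  simp only [thr6B, BExpr.eval, AExpr.eval, shlE_eval, aE_eval, four_pow_eq_two_pow, pow_succ, pow_zero, pow_mul',
    one_mul]
  congr 1 <;> apply Bool.decide_congr <;> constructor <;> intro h <;> · ring_nf at h ⊢; omega

/-- `T₀` decides `a < 2^k / 2`. [folklore] -/
theorem thr0B_eval : (thr0B k).eval inp = decide (((inp % 2 ^ k : ℕ) : ℝ) < 2 ^ k * (1 / 2)) := by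
  rw [thr0B_eval_nat]; exact Bool.decide_congr (thr0_iff k _)

/-- `T₆` decides `a < 2^k (1 + √5)/4`. [folklore] -/
theorem thr6B_eval : (thr6B k).eval inp = decide (((inp % 2 ^ k : ℕ) : ℝ) < 2 ^ k * ((1 + Real.sqrt 5) / 4)) := by
  rw [thr6B_eval_nat]; exact Bool.decide_congr (thr6_iff k _)

/-- `T₂` decides `a < 2^k (1 − 1/√φ)/2`. [folklore] -/
theorem thr2B_eval : (thr2B k).eval inp = decide (((inp % 2 ^ k : ℕ) : ℝ) < 2 ^ k * ((1 - 1 / Real.sqrt goldenRatio) / 2)) := by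
  rw [thr2B_eval_nat]; exact Bool.decide_congr (thr2_iff k _)

/-- `T₃` decides `a < 2^k (1 + 1/√φ)/2`. [folklore] -/
theorem thr3B_eval : (thr3B k).eval inp = decide (((inp % 2 ^ k : ℕ) : ℝ) < 2 ^ k * ((1 + 1 / Real.sqrt goldenRatio) / 2)) := by
  rw [thr3B_eval_nat]; exact Bool.decide_congr (thr3_iff k _)

/-- `T₄` decides `a < 2^k (3 + √5)/8`. [folklore] -/
theorem thr4B_eval : (thr4B k).eval inp = decide (((inp % 2 ^ k : ℕ) : ℝ) < 2 ^ k * ((3 + Real.sqrt 5) / 8)) := by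
  rw [thr4B_eval_nat]; exact Bool.decide_congr (thr4_iff k _)

/-- `T₅` decides `a < 2^k (4 − √(10+2√5))/8`. [folklore] -/
theorem thr5B_eval : (thr5B k).eval inp = decide (((inp % 2 ^ k : ℕ) : ℝ) < 2 ^ k * ((4 - Real.sqrt (10 + 2 * Real.sqrt 5)) / 8)) := by
  rw [thr5B_eval_nat]; exact Bool.decide_congr (thr5_iff k _)

end Eval

/-! ### Side conditions and overflow bounds -/

section Bounds

variable (k : ℕ)

/-- The arithmetic leaves of a Boolean expression. [folklore] -/
def BExpr.leaves : BExpr → List AExpr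
  | .lt e₁ e₂ => [e₁, e₂]
  | .not b => b.leaves
  | .and b₁ b₂ => b₁.leaves ++ b₂.leaves
  | .or b₁ b₂ => b₁.leaves ++ b₂.leaves

/-- The intermediate bound of a Boolean expression is below `M` as soon as the bounds of its leaves
are. [folklore] -/
theorem BExpr.maxBnd_lt_of_leaves {M : ℕ} : ∀ b : BExpr, (∀ e ∈ b.leaves, e.bnd < M) → b.maxBnd < M
  | .lt e₁ e₂, h => by
    simp only [BExpr.maxBnd, max_lt_iff]
    exact ⟨lt_of_le_of_lt e₁.maxBnd_le_bnd (h e₁ (by simp [BExpr.leaves])), lt_of_le_of_lt e₂.maxBnd_le_bnd (h e₂ (by simp [BExpr.leaves]))⟩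
  | .not b, h => b.maxBnd_lt_of_leaves h
  | .and b₁ b₂, h => by
    simp only [BExpr.maxBnd, max_lt_iff]
    exact ⟨b₁.maxBnd_lt_of_leaves fun e he => h e (by simp [BExpr.leaves, he]), b₂.maxBnd_lt_of_leaves fun e he => h e (by simp [BExpr.leaves, he])⟩
  | .or b₁ b₂, h => by
    simp only [BExpr.maxBnd, max_lt_iff]
    exact ⟨b₁.maxBnd_lt_of_leaves fun e he => h e (by simp [BExpr.leaves, he]), b₂.maxBnd_lt_of_leaves fun e he => h e (by simp [BExpr.leaves, he])⟩

/-- The `OK` side conditions of a Boolean expression follow from those of its leaves. [folklore] -/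
theorem BExpr.ok_of_leaves {Wd kIn : ℕ} : ∀ b : BExpr, (∀ e ∈ b.leaves, e.OK Wd kIn) → b.OK Wd kIn
  | .lt e₁ e₂, h => ⟨h e₁ (by simp [BExpr.leaves]), h e₂ (by simp [BExpr.leaves])⟩
  | .not b, h => b.ok_of_leaves h
  | .and b₁ b₂, h => ⟨b₁.ok_of_leaves fun e he => h e (by simp [BExpr.leaves, he]), b₂.ok_of_leaves fun e he => h e (by simp [BExpr.leaves, he])⟩
  | .or b₁ b₂, h => ⟨b₁.ok_of_leaves fun e he => h e (by simp [BExpr.leaves, he]), b₂.ok_of_leaves fun e he => h e (by simp [BExpr.leaves, he])⟩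

/-- Powers of `N = 2^k ≥ 1` are monotone in the exponent (the hints fed to `omega`). [folklore] -/
theorem two_pow_hints : 1 ≤ 2 ^ k ∧ 2 ^ k ≤ (2 ^ k) ^ 2 ∧ (2 ^ k) ^ 2 ≤ (2 ^ k) ^ 3 ∧ (2 ^ k) ^ 3 ≤ (2 ^ k) ^ 4 := by
  have h1 : 1 ≤ 2 ^ k := Nat.one_le_two_pow
  refine ⟨h1, ?_, ?_, ?_⟩
  · calc 2 ^ k = 2 ^ k * 1 := (mul_one _).symm
      _ ≤ 2 ^ k * 2 ^ k := Nat.mul_le_mul_left _ h1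
      _ = (2 ^ k) ^ 2 := (sq _).symm
  · calc (2 ^ k) ^ 2 = (2 ^ k) ^ 2 * 1 := (mul_one _).symm
      _ ≤ (2 ^ k) ^ 2 * 2 ^ k := Nat.mul_le_mul_left _ h1
      _ = (2 ^ k) ^ 3 := (pow_succ _ 2).symm
  · calc (2 ^ k) ^ 3 = (2 ^ k) ^ 3 * 1 := (mul_one _).symm
      _ ≤ (2 ^ k) ^ 3 * 2 ^ k := Nat.mul_le_mul_left _ h1
      _ = (2 ^ k) ^ 4 := (pow_succ _ 3).symm

/-- The width used for all threshold programs. [folklore] -/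
abbrev thrWd (k : ℕ) : ℕ := 4 * k + 16

/-- **Overflow bounds**: every intermediate value of the seven threshold programs fits in `4k + 16`
bits. [folklore] -/
theorem thrB_maxBnd_lt :
    (thr0B k).maxBnd < 2 ^ thrWd k ∧ (thr1B k).maxBnd < 2 ^ thrWd k ∧ (thr2B k).maxBnd < 2 ^ thrWd k ∧
    (thr3B k).maxBnd < 2 ^ thrWd k ∧ (thr4B k).maxBnd < 2 ^ thrWd k ∧ (thr5B k).maxBnd < 2 ^ thrWd k ∧
    (thr6B k).maxBnd < 2 ^ thrWd k := by
  obtain ⟨h1, h2, h3, h4⟩ := two_pow_hints k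
  have e16 : 2 ^ thrWd k = (2 ^ k) ^ 4 * 65536 := by rw [thrWd, pow_add, pow_mul']; norm_num
  refine ⟨?_, ?_, ?_, ?_, ?_, ?_, ?_⟩ <;> refine BExpr.maxBnd_lt_of_leaves _ fun e he => ?_ <;>
    simp only [thr0B, thr1B, thr2B, thr3B, thr4B, thr5B, thr6B, pE, qE, p'E, q'E, p''E, q''E, BExpr.leaves, List.mem_cons,
      List.mem_append, List.not_mem_nil, or_false, or_assoc] at he <;>
    rcases he with rfl | rfl | rfl | rfl | rfl | rfl | rfl | rfl <;>
    · simp only [AExpr.bnd, shlE_bnd, aE_bnd, e16, pow_mul', pow_succ, pow_zero, one_mul]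
      ring_nf at h1 h2 h3 h4 ⊢; omega

/-- **Side conditions**: the threshold programs read the field `a` of `k ≤ kIn` bits and use powers
of two below the width. [folklore] -/
theorem thrB_ok {kIn : ℕ} (hk : k ≤ kIn) :
    (thr0B k).OK (thrWd k) kIn ∧ (thr1B k).OK (thrWd k) kIn ∧ (thr2B k).OK (thrWd k) kIn ∧ (thr3B k).OK (thrWd k) kIn ∧
    (thr4B k).OK (thrWd k) kIn ∧ (thr5B k).OK (thrWd k) kIn ∧ (thr6B k).OK (thrWd k) kIn := by
  refine ⟨?_, ?_, ?_, ?_, ?_, ?_, ?_⟩ <;> refine BExpr.ok_of_leaves _ fun e he => ?_ <;>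
    simp only [thr0B, thr1B, thr2B, thr3B, thr4B, thr5B, thr6B, pE, qE, p'E, q'E, p''E, q''E, BExpr.leaves, List.mem_cons,
      List.mem_append, List.not_mem_nil, or_false, or_assoc] at he <;>
    rcases he with rfl | rfl | rfl | rfl | rfl | rfl | rfl | rfl <;>
    · simp only [AExpr.OK, shlE, zeroE, aE, thrWd]; omega

/-- A bit test is `OK` when the bit is an input bit. [folklore] -/
theorem bitB_ok {Wd kIn off : ℕ} (h : off < kIn) (hW : 1 ≤ Wd) : (bitB off).OK Wd kIn := by
  simp only [bitB, BExpr.OK, AExpr.OK, zeroE]; omega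

/-- A bit test has tiny intermediate values. [folklore] -/
theorem bitB_maxBnd (off : ℕ) : (bitB off).maxBnd = 2 := by
  simp [bitB, BExpr.maxBnd, AExpr.maxBnd, AExpr.bnd, zeroE]

end Bounds

end SLP

end Literature.Computability.QuantumComplexity

end
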